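import Summits.ResolutionOfSingularities.ResolutionOfSingularities.Theorems.PurelyInseparableDim4ResConeCornerRigidity
import Summits.ResolutionOfSingularities.ResolutionOfSingularities.Theorems.PurelyInseparableDim4ResConeCornerAxis
import Summits.ResolutionOfSingularities.ResolutionOfSingularities.Theorems.PurelyInseparableDim4ResConeCornerGame
import HarnessLib
import HarnessLib.Audit.Tags

/-!
# Purely inseparable four-folds — THE FRAME AT ONE TIME SUFFICES: a constant-`(d, e_G = 2)` tail on two permanent
# light boundary letters whose polar kernel is the coordinate plane `⟨e_a, e_{a′}⟩` and whose level-1 axes are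
# empty AT ONE STATE is rigid for ever — hence impossible by `…ResConeCornerGame`
# (K2(p) lane, SLICE C (C7c), file-holder res-dim4-p-5 g3)

[OURS · counted 0 · cell `res-dim4-pi` · K2(p) lane (desk WORDS #78 (d), #80 (d)) · seat res-dim4-p-5 g3.]
Nothing here proves K2(p), `NoIsolatedTrap p p` or resolution of singularities in dimension ≥ 4 /
characteristic `p`.

`…ResConeCornerGame.no_pureCorner_frame_tail` needs the frame (pure corners, cone free of `x_a, x_{a′}`) at EVERY
state of the tail.  This file derives it from ONE state:

* `step_r_apply_eq_zero_of_ne` — a translated letter loses its component (`b_i ≠ 0 ⇒ r′_i = 0`);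
* `corner_of_frame` — with `resVertex (c k) = ⟨e_a, e_{a′}⟩` and BOTH letters boundary letters of the child,
  the step `k` is a PURE CORNER: its direction lies in the kernel ((VT)(i)), so the translation is along the
  other active letter, which would kill that letter's component;
* `frame_succ` — INVARIANT PROPAGATION: frame + empty level-1 axes (slots `x^r·x_a^i·y^{d−1}`,
  `x^r·x_{a′}^i·y^{d−1}`, `i ≥ 2`) at `k` ⇒ the same at `k + 1` (`…CornerRigidity` for the kernel, `…CornerAxis`
  for the axes: the chart axis marches down, the other is emptied);
* **`no_rigidFrame_tail`** — THE THEOREM: no isolated above-floor witnessed `Step0 p` chain with `x^{r₀} ∣ F₀`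
  has, from some `k₀` on, constant natural shade `d < p`, `e_G ≡ 2`, chart letters in `{a, a′}`, both letters
  boundary letters (`r_k(a), r_k(a′) ≥ 1`), light letters (`r_k(a) + r_k(a′) ≤ 2 r_{k+1}(j k)`), AND at the single
  time `k₀`: `e_a, e_{a′} ∈ resVertex (c k₀)` with the level-1 axes of `F_{k₀}` empty beyond `(1,0), (0,1)`.
The class transfer (idea-4 A∞/C∞: reach such a `k₀` by ONE linear straightening after the first letter change,
the other letter's corner having emptied the axis) is (C7d).
[cite: CossartJannsenSaito2020, Thm. 3.10(4), Thm. 3.14, Lemma 13.2, Lemma 13.4, Thm. 13.7]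
bears_on: LADDER-RESOLUTION:D157-DOOR2 (res-dim4-pi · K2(p) = `RidgeBudget.NoAboveFloorTrap p p` · slice C).
Supports stmt-ResolutionOfSingularities-16155 (helper).
-/

set_option linter.dupNamespace false -- mandated namespace of this single-conjunct summit

noncomputable section

namespace Summit.ResolutionOfSingularities.ResolutionOfSingularities.Theorems.PIDim4

namespace ResCone

open MvPolynomial Finset
open Literature.AlgebraicGeometry.Resolution
open Literature.AlgebraicGeometry.Resolution.CentreBlowup
open Literature.AlgebraicGeometry.Resolution.Hauser2010
open Literature.AlgebraicGeometry.Resolution.HauserPerlega2019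
open PointBlowup (polarMap additiveSubspace direction)

variable {K : Type} [Field K]

section Tail

variable (p : ℕ) [Fact p.Prime] [DecidableEq K]

omit [Fact p.Prime] in
/-- **A translated letter loses its component**: if `b_i ≠ 0` (`i ≠ j`) then `r′_i = 0`.
[cite: HauserPerlega2019PRIMS, §2 (transform D′ of D)] -/
theorem step_r_apply_eq_zero_of_ne (j : Fin 4) {b : Fin 4 → K} (hbj : b j = 0) (s : State K) {o : ℕ}
    (ho : ordZero s.F = o) (hr : ∀ d ∈ s.F.support, s.r ≤ d) {i : Fin 4} (hij : i ≠ j) (hbi : b i ≠ 0) :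
    (CentreBlowup.step p Finset.univ j b s).r i = 0 := by
  rw [step_r_univ p j hbj s ho hr, Finsupp.coe_update, Function.update_of_ne hij, Finsupp.filter_apply,
    if_neg hbi]

/-- **A frame state steps by a PURE CORNER**: on the constant-shade tail, if `resVertex (c k)` is the plane
`⟨e_a, e_{a′}⟩`, the chart is `a` or `a′`, and both letters are boundary letters of the CHILD, then `b k = 0`.
[OURS] [cite: CossartJannsenSaito2020, Thm. 3.14] -/
theorem corner_of_frame {c : ℕ → State K} {j : ℕ → Fin 4} {b : ℕ → Fin 4 → K}
    (hc : ∀ k, IsIsolated p (c k).F ∧ Step0 p (c k) (c (k + 1))) (hw : FreeTail.IsWitnessedChain p c j b)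
    (hr0 : ∀ e ∈ (c 0).F.support, (c 0).r ≤ e) (hfloor : ∀ k, ordZero (c k).F ≠ p) {k₀ : ℕ} {d : ℕ∞}
    (hshade : ∀ k, k₀ ≤ k → (c k).shade = d) {a a' : Fin 4} (haa : a ≠ a') {k : ℕ} (hk : k₀ ≤ k)
    (hjk : j k = a ∨ j k = a') (he : Module.finrank K (resVertex (c k)) = 2)
    (ha : (Pi.single a 1 : Fin 4 → K) ∈ resVertex (c k)) (ha' : (Pi.single a' 1 : Fin 4 → K) ∈ resVertex (c k))
    (hbdry : 1 ≤ (c (k + 1)).r a ∧ 1 ≤ (c (k + 1)).r a') : b k = 0 := by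
  obtain ⟨o, ho, -, -⟩ := chain_band p hc hfloor k
  have hrk := IsolatedBand.isolated_chain_forall_le hc hr0 k
  have hv := chain_direction_mem_resVertex p hc hw hr0 hfloor hshade hk
  have hbj : b k (j k) = 0 := (hw k).2.1
  have hstep := (hw k).2.2.2.2
  -- the direction, cleared of its active components, is a kernel vector inside `H_a ∩ H_{a′}`: zero
  set w : Fin 4 → K := direction (j k) (b k) - direction (j k) (b k) a • Pi.single a 1 -
    direction (j k) (b k) a' • Pi.single a' 1 with hwdef
  have hwmem : w ∈ resVertex (c k) :=
    Submodule.sub_mem _ (Submodule.sub_mem _ hv (Submodule.smul_mem _ _ ha)) (Submodule.smul_mem _ _ ha')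
  have hwa : w a = 0 := by
    simp only [hwdef, Pi.sub_apply, Pi.smul_apply, Pi.single_eq_same, Pi.single_eq_of_ne haa, smul_eq_mul,
      mul_one, mul_zero, sub_self]
  have hwa' : w a' = 0 := by
    simp only [hwdef, Pi.sub_apply, Pi.smul_apply, Pi.single_eq_same, Pi.single_eq_of_ne haa.symm, smul_eq_mul,
      mul_one, mul_zero, sub_zero, sub_self]
  have hw0 := eq_zero_of_mem_of_finrank_eq_two haa he ha ha' hwmem hwa hwa'
  -- hence every passive component of `b k` vanishes …
  have hpass : ∀ i, i ≠ a → i ≠ a' → b k i = 0 := by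
    intro i hia hia'
    have hij : i ≠ j k := by rcases hjk with h | h <;> rw [h] <;> assumption
    have hwi : w i = 0 := by rw [hw0]; rfl
    simp only [hwdef, Pi.sub_apply, Pi.smul_apply, Pi.single_eq_of_ne hia, Pi.single_eq_of_ne hia',
      smul_eq_mul, mul_zero, sub_zero, direction_apply_of_ne hij] at hwi
    exact hwi
  -- … and the other active letter is not translated, lest it lose its component
  have hact : b k a = 0 ∧ b k a' = 0 := by
    rcases hjk with h | h
    · refine ⟨by rw [← h]; exact hbj, ?_⟩
      by_contra hne
      have h0 := step_r_apply_eq_zero_of_ne p (j k) hbj (c k) ho hrk (by rw [h]; exact haa.symm) hne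
      rw [← hstep] at h0
      exact absurd h0 (by have := hbdry.2; omega)
    · refine ⟨?_, by rw [← h]; exact hbj⟩
      by_contra hne
      have h0 := step_r_apply_eq_zero_of_ne p (j k) hbj (c k) ho hrk (by rw [h]; exact haa) hne
      rw [← hstep] at h0
      exact absurd h0 (by have := hbdry.1; omega)
  funext i
  by_cases hia : i = a
  · rw [hia]; exact hact.1
  · by_cases hia' : i = a'
    · rw [hia']; exact hact.2
    · exact hpass i hia hia'

/-- **INVARIANT PROPAGATION**: frame (`e_a, e_{a′} ∈ resVertex`) + empty level-1 axes beyond `1` at time `k`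
give the same at time `k + 1`, on a constant-`(d, e_G = 2)` tail with chart letters in `{a, a′}` and both letters
boundary letters of the child. [OURS] [cite: CossartJannsenSaito2020, Thm. 3.10(4), Lemma 13.2, Lemma 13.4] -/
theorem frame_succ [CharP K p] {c : ℕ → State K} {j : ℕ → Fin 4} {b : ℕ → Fin 4 → K}
    (hc : ∀ k, IsIsolated p (c k).F ∧ Step0 p (c k) (c (k + 1))) (hw : FreeTail.IsWitnessedChain p c j b)
    (hr0 : ∀ e ∈ (c 0).F.support, (c 0).r ≤ e) (hfloor : ∀ k, ordZero (c k).F ≠ p) {k₀ d : ℕ} (hdp : d < p)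
    (hshade : ∀ k, k₀ ≤ k → (c k).shade = (d : ℕ∞)) {a a' : Fin 4} (haa : a ≠ a') {k : ℕ} (hk : k₀ ≤ k)
    (hjk : j k = a ∨ j k = a') (he : Module.finrank K (resVertex (c k)) = 2)
    (he' : Module.finrank K (resVertex (c (k + 1))) = 2)
    (hbdry : 1 ≤ (c (k + 1)).r a ∧ 1 ≤ (c (k + 1)).r a')
    (hframe : (Pi.single a 1 : Fin 4 → K) ∈ resVertex (c k) ∧ (Pi.single a' 1 : Fin 4 → K) ∈ resVertex (c k))
    (haxes : ∀ i, 2 ≤ i → ∀ ν : Fin 4 →₀ ℕ, ν a = 0 → ν a' = 0 → ν.degree + 1 = d →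
      coeff ((c k).r + ν + Finsupp.single a i) (c k).F = 0 ∧
        coeff ((c k).r + ν + Finsupp.single a' i) (c k).F = 0) :
    b k = 0 ∧
      ((Pi.single a 1 : Fin 4 → K) ∈ resVertex (c (k + 1)) ∧
        (Pi.single a' 1 : Fin 4 → K) ∈ resVertex (c (k + 1))) ∧
      (∀ i, 2 ≤ i → ∀ ν : Fin 4 →₀ ℕ, ν a = 0 → ν a' = 0 → ν.degree + 1 = d →
        coeff ((c (k + 1)).r + ν + Finsupp.single a i) (c (k + 1)).F = 0 ∧
          coeff ((c (k + 1)).r + ν + Finsupp.single a' i) (c (k + 1)).F = 0) := by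
  have hb := corner_of_frame p hc hw hr0 hfloor hshade haa hk hjk he hframe.1 hframe.2 hbdry
  obtain ⟨o, ho, hpo, ho2⟩ := BandShade.exists_ordZero_eq p hc k
  have hp2 : 2 ≤ p := (Fact.out : p.Prime).two_le
  have hpo' : p < o := lt_of_le_of_ne hpo (fun h => hfloor k (by rw [ho, h]))
  have hrk := IsolatedBand.isolated_chain_forall_le hc hr0 k
  have hd : o - (c k).r.degree = d := ordZero_sub_degree_eq_of_shade ho (hshade k hk)
  have hstep : c (k + 1) = CentreBlowup.step p Finset.univ (j k) 0 (c k) := by rw [(hw k).2.2.2.2, hb]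
  have heqsh : (CentreBlowup.step p Finset.univ (j k) 0 (c k)).shade = (c k).shade := by
    rw [← hstep, hshade (k + 1) (by omega), hshade k hk]
  refine ⟨hb, ?_, ?_⟩
  · -- the kernel: corner rigidity in the chart of the step (slot `2` of that letter's axis is empty)
    rcases hjk with hja | hja'
    · rw [hja] at hstep heqsh
      have he'' : Module.finrank K (resVertex (CentreBlowup.step p Finset.univ a 0 (c k))) = 2 := by
        rw [← hstep]; exact he'
      have h := single_mem_resVertex_step_of_slot_empty p haa ho hrk hpo' (by omega) heqsh (by omega) he
        hframe.1 hframe.2 he'' (fun ν hνa hνa' hν => (haxes 2 le_rfl ν hνa hνa' (by omega)).1)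
      rw [hstep]; exact h
    · rw [hja'] at hstep heqsh
      have he'' : Module.finrank K (resVertex (CentreBlowup.step p Finset.univ a' 0 (c k))) = 2 := by
        rw [← hstep]; exact he'
      have h := single_mem_resVertex_step_of_slot_empty p haa.symm ho hrk hpo' (by omega) heqsh (by omega) he
        hframe.2 hframe.1 he'' (fun ν hνa' hνa hν => (haxes 2 le_rfl ν hνa hνa' (by omega)).2)
      rw [hstep]; exact ⟨h.2, h.1⟩
  · -- the axes: the chart axis marches down, the other one is emptied
    intro i hi ν hνa hνa' hν
    rcases hjk with hja | hja'
    · rw [hja] at hstep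
      rw [hstep]
      exact ⟨axisSlot_step_zero_same p haa (c k) ho hrk hpo (hd) i
          (fun μ hμa hμa' hμ => (haxes (i + 1) (by omega) μ hμa hμa' hμ).1) ν hνa hνa' hν,
        axisSlot_step_zero_other p haa.symm (c k) ho hrk hpo hd hi ν hνa' hνa hν⟩
    · rw [hja'] at hstep
      rw [hstep]
      exact ⟨axisSlot_step_zero_other p haa (c k) ho hrk hpo hd hi ν hνa hνa' hν,
        axisSlot_step_zero_same p haa.symm (c k) ho hrk hpo hd i
          (fun μ hμa' hμa hμ => (haxes (i + 1) (by omega) μ hμa hμa' hμ).2) ν hνa' hνa hν⟩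

/-- **THE FRAME AT ONE TIME SUFFICES** (every prime): there is no isolated above-floor witnessed `Step0 p` chain
with `x^{r₀} ∣ F₀` which, from some `k₀` on, has constant natural shade `d < p`, `e_G ≡ 2`, chart letters in
`{a, a′}`, both letters boundary letters, light letters, and AT TIME `k₀` the polar kernel `⟨e_a, e_{a′}⟩` together
with empty level-1 axes beyond `(1,0), (0,1)`.  (Rigidity makes every later step a pure corner reproducing the
frame; `…ResConeCornerGame.no_pureCorner_frame_tail` finishes.) [OURS]
[cite: CossartJannsenSaito2020, Thm. 3.10(4), Thm. 3.14, Lemma 13.2, Lemma 13.4, Thm. 13.7] -/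
theorem no_rigidFrame_tail [CharP K p] {c : ℕ → State K} {j : ℕ → Fin 4} {b : ℕ → Fin 4 → K}
    (hc : ∀ k, IsIsolated p (c k).F ∧ Step0 p (c k) (c (k + 1))) (hw : FreeTail.IsWitnessedChain p c j b)
    (hr0 : ∀ e ∈ (c 0).F.support, (c 0).r ≤ e) (hfloor : ∀ k, ordZero (c k).F ≠ p) {k₀ d : ℕ} (hdp : d < p)
    (hshade : ∀ k, k₀ ≤ k → (c k).shade = (d : ℕ∞)) {a a' : Fin 4} (haa : a ≠ a')
    (hletters : ∀ k, k₀ ≤ k → (j k = a ∨ j k = a'))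
    (he : ∀ k, k₀ ≤ k → Module.finrank K (resVertex (c k)) = 2)
    (hbdry : ∀ k, k₀ ≤ k → 1 ≤ (c k).r a ∧ 1 ≤ (c k).r a')
    (hlight : ∀ k, k₀ ≤ k → (c k).r a + (c k).r a' ≤ 2 * (c (k + 1)).r (j k))
    (hframe : (Pi.single a 1 : Fin 4 → K) ∈ resVertex (c k₀) ∧ (Pi.single a' 1 : Fin 4 → K) ∈ resVertex (c k₀))
    (haxes : ∀ i, 2 ≤ i → ∀ ν : Fin 4 →₀ ℕ, ν a = 0 → ν a' = 0 → ν.degree + 1 = d →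
      coeff ((c k₀).r + ν + Finsupp.single a i) (c k₀).F = 0 ∧
        coeff ((c k₀).r + ν + Finsupp.single a' i) (c k₀).F = 0) : False := by
  -- the invariant «frame + empty axes» for every `k ≥ k₀`, with the pure corner as a by-product
  have hinv : ∀ k, k₀ ≤ k →
      ((Pi.single a 1 : Fin 4 → K) ∈ resVertex (c k) ∧ (Pi.single a' 1 : Fin 4 → K) ∈ resVertex (c k)) ∧
      (∀ i, 2 ≤ i → ∀ ν : Fin 4 →₀ ℕ, ν a = 0 → ν a' = 0 → ν.degree + 1 = d →
        coeff ((c k).r + ν + Finsupp.single a i) (c k).F = 0 ∧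
          coeff ((c k).r + ν + Finsupp.single a' i) (c k).F = 0) := by
    intro k hk
    induction k, hk using Nat.le_induction with
    | base => exact ⟨hframe, haxes⟩
    | succ k hk ih =>
      have h := frame_succ p hc hw hr0 hfloor hdp hshade haa hk (hletters k hk) (he k hk) (he (k + 1) (by omega))
        (hbdry (k + 1) (by omega)) ih.1 ih.2
      exact ⟨h.2.1, h.2.2⟩
  have hcorner : ∀ k, k₀ ≤ k → b k = 0 := fun k hk =>
    corner_of_frame p hc hw hr0 hfloor hshade haa hk (hletters k hk) (he k hk) (hinv k hk).1.1 (hinv k hk).1.2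
      (hbdry (k + 1) (by omega))
  refine no_pureCorner_frame_tail p hc hw hr0 hfloor hshade haa hcorner hletters (fun k hk => ?_) hlight
  obtain ⟨o, ho, -, -⟩ := chain_band p hc hfloor k
  have hd : o - (c k).r.degree = d := ordZero_sub_degree_eq_of_shade ho (hshade k hk)
  exact free_of_single_mem_resVertex p ho (by rw [hd]; exact hdp) (hinv k hk).1.1 (hinv k hk).1.2

end Tail

end ResCone

end Summit.ResolutionOfSingularities.ResolutionOfSingularities.Theorems.PIDim4

end
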